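import Summits.AtomisticToContinuum.Crystallization.Theorems.ChartedZeroExcessLayeredLatticeLiouvilleZZZXB

/-!
# ChartedZeroExcess · LayeredLatticeLiouville ZZZXC (lens-2 g89 NODE 89 part 4 «TripodKit», ADDENDUM to tree ZZZXB) — the finite-dimensional
# toolkit g90 needs for the S-side leaf of record (RG-lab″) `CoreLightLabelTreeP`: every ingredient of a `TripodAt` and of an `IsLightLabelTree`
# that is NOT about the configuration `S` is settled here, once.
#   §1 ℓ¹-FATNESS OF A TRIPLE: the lower-bound form `IsLowerFat μ u := ∀ α, μ·Σ|α m| ≤ ‖Σ α m • u m‖`; it is TRANSPORTED by a scaled isometry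
#      (`isLowerFat_smul_map`, constant `a·μ`), survives a PERTURBATION of each vector by `≤ τ` (`isLowerFat_of_near`, constant `μ − τ` — no matrix
#      inverse, no Neumann series), and for `μ > 0` yields the EXISTENCE form of `TripodAt` (`exists_coeff_of_isLowerFat`: `∀ z, ∃ α, z = Σ α m • u m ∧
#      Σ|α m| ≤ ‖z‖/μ`, by injective ⇒ surjective in dimension `3`).
#   §2 THE CANONICAL TRIPLE `canonTriple = {(0,1,1), (1,0,1), (1,1,0)}/√2`: it lies in BOTH kissing patterns (the cuboctahedron AND the anticuboctahedron
#      — in the tree's integer models it is `fccInt ∩ (hcpInt/3)`'s upper triangle), hence in both two-shell patterns (`canonTriple_mem_of_pattern`), has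
#      unit vectors, and is `2/5`-fat (`isLowerFat_canonTriple`: `‖Σ α m • c m‖² = (|α|₂² + (Σ α)²)/2 ≥ |α|₁²/6`).
#   §3 THE TRIPOD CONSTRUCTOR `tripodAt_of_near_canonTriple`: three sites within `τ` of `y₀ j + a • A (canonTriple m)` (`A` a linear isometry, `a ≥ 0`)
#      and in label range give `TripodAt Rd μ y₀ p j tr` for every `0 < μ ≤ (2/5)·a − τ` (record: `a ≥ 9/10`, `τ = a/16 + 10⁻⁴` ⇒ any `μ ≤ 3/10`).
#   §4 THE DIAMETER IS FREE: clauses (root, depth decrease, depth `≤ H`, parent in range `Rd`) already give label diameter `≤ 2·H·Rd`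
#      (`dist_le_of_treeClauses`), so `isLightLabelTree_of_clauses` builds an `IsLightLabelTree Rd μ (2·H·Rd) H …` with NO diameter computation.
#   §5 THE HOP IN `S`: `clean_descent_step` (tree ZZZVA `shadow_descent_step` without shadow/placement), `descent_gain_far` (for `D ≥ 3` the linear gain
#      `9/20`), and the packaged hops `clean_hop_sq` / `clean_hop_far`: at a clean point at distance `D ≥ 4/5` (resp. `≥ 3`) from any target there is a
#      BONDED site (`≠`, `≤ 17/16`) with `dist² ≤ D² − 1/100` (resp. `dist ≤ D − 9/20`) — the parent step of the band recipe.
# With §§1–5, what g90 proves about `S` is exactly PLAN-g90-RGlab §2 (the band/depth recipe and deepness) and the label pull-back of §3 there.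
# 0 sorry · import = tree ZZZXB only · 3 defs (`IsLowerFat` (Prop), `canonInt`, `canonTriple`) · no instances/notation · axioms standard.
-/

noncomputable section

open scoped BigOperators RealInnerProductSpace
open MeasureTheory Set Metric Filter Topology
open Summit.AtomisticToContinuum.Crystallization.Theorems.ChartedPlanarOrderRigidityDoor (E3)
open Literature.Geometry.DiscreteGeometry (IsTwoShellGoodSet fccTwoShellPattern hcpTwoShellPattern fccKissingPattern hcpKissingPattern fccKissingPattern_subset
  hcpKissingPattern_subset intVec intVec_apply fccInt hcpInt scaledPattern norm_eq_one_of_mem_fccKissingPattern)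

namespace Summit.AtomisticToContinuum.Crystallization.Theorems.ChartedZeroExcessLayeredLatticeLiouville

/-! ### ZZZXC-1  ℓ¹-fatness of a triple: lower-bound form, transport, perturbation, existence form (PROVED) -/

section Fat

/-- **`IsLowerFat μ u`** — LOWER `ℓ¹`-FATNESS `μ` of a triple `u : Fin 3 → E3`: `μ·Σ|α m| ≤ ‖Σ α m • u m‖` for every coefficient vector `α`.
(For `μ > 0` equivalent to the existence form used in `TripodAt`, `exists_coeff_of_isLowerFat`; this form is the one that transports and perturbs.) -/
def IsLowerFat (μ : ℝ) (u : Fin 3 → E3) : Prop :=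
  ∀ α : Fin 3 → ℝ, μ * ∑ m, |α m| ≤ ‖∑ m, α m • u m‖

variable {μ μ' a τ : ℝ} {u v : Fin 3 → E3}

/-- lower fatness is monotone in the constant. -/
theorem IsLowerFat.mono (h : IsLowerFat μ u) (hμ : μ' ≤ μ) : IsLowerFat μ' u := fun α =>
  (mul_le_mul_of_nonneg_right hμ (Finset.sum_nonneg fun m _ => abs_nonneg (α m))).trans (h α)

/-- TRANSPORT (PROVED): a scaled linear isometry `x ↦ a • A x` (`a ≥ 0`) multiplies the lower fatness constant by `a`. -/
theorem isLowerFat_smul_map (A : E3 →ₗᵢ[ℝ] E3) (ha : 0 ≤ a) (h : IsLowerFat μ v) : IsLowerFat (a * μ) (fun m => a • A (v m)) := by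
  intro α
  have e : ∑ m, α m • (a • A (v m)) = a • A (∑ m, α m • v m) := by
    rw [map_sum, Finset.smul_sum]
    refine Finset.sum_congr rfl fun m _ => ?_
    rw [map_smul, smul_comm]
  rw [e, norm_smul, Real.norm_of_nonneg ha, LinearIsometry.norm_map, mul_assoc]
  exact mul_le_mul_of_nonneg_left (h α) ha

/-- PERTURBATION (PROVED, inverse-free): moving each vector by `≤ τ` costs at most `τ` of lower fatness. -/
theorem isLowerFat_of_near (h : IsLowerFat μ v) (huv : ∀ m, ‖u m - v m‖ ≤ τ) : IsLowerFat (μ - τ) u := by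
  intro α
  have h1 := h α
  have h2 : ‖∑ m, α m • (u m - v m)‖ ≤ ∑ m, |α m| * τ := by
    refine (norm_sum_le _ _).trans (Finset.sum_le_sum fun m _ => ?_)
    rw [norm_smul, Real.norm_eq_abs]
    exact mul_le_mul_of_nonneg_left (huv m) (abs_nonneg _)
  have h3 : ∑ m, α m • v m = ∑ m, α m • u m - ∑ m, α m • (u m - v m) := by
    rw [← Finset.sum_sub_distrib]
    refine Finset.sum_congr rfl fun m _ => ?_
    rw [smul_sub]; abel
  have h4 : ‖∑ m, α m • v m‖ ≤ ‖∑ m, α m • u m‖ + ‖∑ m, α m • (u m - v m)‖ := by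
    rw [h3]; exact norm_sub_le _ _
  have h5 : ∑ m, |α m| * τ = τ * ∑ m, |α m| := by rw [← Finset.sum_mul, mul_comm]
  rw [sub_mul]
  linarith

/-- EXISTENCE FORM (PROVED): a `μ`-lower-fat triple with `μ > 0` spans `E3` with `ℓ¹`-controlled coefficients — the second clause of `TripodAt`.
(The combination map `(Fin 3 → ℝ) →ₗ E3` is injective by the lower bound, hence surjective: equal finite dimension `3`.) -/
theorem exists_coeff_of_isLowerFat (hμ : 0 < μ) (h : IsLowerFat μ u) :
    ∀ z : E3, ∃ α : Fin 3 → ℝ, z = ∑ m, α m • u m ∧ ∑ m, |α m| ≤ ‖z‖ / μ := by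
  let B : (Fin 3 → ℝ) →ₗ[ℝ] E3 :=
    { toFun := fun α => ∑ m, α m • u m
      map_add' := fun α β => by
        simp only [Pi.add_apply, add_smul, Finset.sum_add_distrib]
      map_smul' := fun c α => by
        simp only [Pi.smul_apply, smul_eq_mul, mul_smul, Finset.smul_sum, RingHom.id_apply] }
  have hB : ∀ α, B α = ∑ m, α m • u m := fun α => rfl
  have hinj : Function.Injective B := by
    refine (injective_iff_map_eq_zero B).2 fun α hα => ?_
    have h0 := h α
    rw [← hB, hα, norm_zero] at h0
    have hs0 : 0 ≤ ∑ m, |α m| := Finset.sum_nonneg fun m _ => abs_nonneg (α m)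
    have hs : ∑ m, |α m| = 0 := by
      by_contra hne
      have hpos : 0 < ∑ m, |α m| := lt_of_le_of_ne hs0 (Ne.symm hne)
      linarith [mul_pos hμ hpos]
    funext m
    exact abs_eq_zero.1 ((Finset.sum_eq_zero_iff_of_nonneg fun m _ => abs_nonneg (α m)).1 hs m (Finset.mem_univ m))
  have hsurj : Function.Surjective B :=
    (LinearMap.injective_iff_surjective_of_finrank_eq_finrank (by rw [Module.finrank_fin_fun, finrank_euclideanSpace_fin])).1 hinj
  intro z
  obtain ⟨α, hα⟩ := hsurj z
  refine ⟨α, by rw [← hα, hB], ?_⟩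
  rw [le_div_iff₀ hμ, mul_comm, ← hα, hB]
  exact h α

end Fat

/-! ### ZZZXC-2  The canonical fat triple common to the cuboctahedron and the anticuboctahedron (PROVED) -/

section Canon

/-- integer model of the canonical triple: `(0,1,1), (1,0,1), (1,1,0)` — three mutually touching first-shell sites forming, with the centre, a regular
tetrahedron; present in `fccInt` verbatim and, tripled, in `hcpInt` (its "upper triangle"). -/
def canonInt : Fin 3 → Fin 3 → ℤ := ![![0, 1, 1], ![1, 0, 1], ![1, 1, 0]]

/-- ★ **`canonTriple`** — the canonical first-shell triple `{(0,1,1), (1,0,1), (1,1,0)}/√2 ⊂ E3` (unit vectors, pairwise at `60°`). -/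
def canonTriple (m : Fin 3) : E3 := (Real.sqrt 2)⁻¹ • intVec (canonInt m)

/-- the integer triple lies in the fcc integer model. -/
theorem canonInt_mem_fccInt : ∀ m : Fin 3, canonInt m ∈ fccInt := by decide

/-- the tripled integer triple lies in the hcp integer model. -/
theorem three_mul_canonInt_mem_hcpInt : ∀ m : Fin 3, (fun i => 3 * canonInt m i) ∈ hcpInt := by decide

/-- the canonical triple lies in the FCC kissing pattern (cuboctahedron). -/
theorem canonTriple_mem_fccKissingPattern (m : Fin 3) : canonTriple m ∈ fccKissingPattern := by
  refine Finset.mem_image.2 ⟨canonInt m, canonInt_mem_fccInt m, ?_⟩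
  simp [canonTriple]

/-- the canonical triple lies in the HCP kissing pattern (anticuboctahedron): `(3,3,0)/√18 = (1,1,0)/√2` etc. -/
theorem canonTriple_mem_hcpKissingPattern (m : Fin 3) : canonTriple m ∈ hcpKissingPattern := by
  have h18 : Real.sqrt 18 = 3 * Real.sqrt 2 := by
    rw [show (18 : ℝ) = 3 ^ 2 * 2 by norm_num, Real.sqrt_mul (by norm_num) 2, Real.sqrt_sq (by norm_num)]
  have hs : Real.sqrt 2 ≠ 0 := by positivity
  refine Finset.mem_image.2 ⟨fun i => 3 * canonInt m i, three_mul_canonInt_mem_hcpInt m, ?_⟩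
  ext i
  simp only [canonTriple, PiLp.smul_apply, intVec_apply, smul_eq_mul, Int.cast_mul, Int.cast_ofNat, Nat.cast_ofNat, h18]
  field_simp

/-- the canonical triple lies in whichever two-shell pattern a clean atom carries. -/
theorem canonTriple_mem_of_pattern {P : Finset E3} (hP : P = fccTwoShellPattern ∨ P = hcpTwoShellPattern) (m : Fin 3) : canonTriple m ∈ P := by
  rcases hP with rfl | rfl
  · exact fccKissingPattern_subset (canonTriple_mem_fccKissingPattern m)
  · exact hcpKissingPattern_subset (canonTriple_mem_hcpKissingPattern m)

/-- the canonical triple consists of unit vectors. -/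
theorem norm_canonTriple (m : Fin 3) : ‖canonTriple m‖ = 1 :=
  norm_eq_one_of_mem_fccKissingPattern (canonTriple_mem_fccKissingPattern m)

/-- ★ **THE CANONICAL TRIPLE IS `2/5`-FAT (PROVED)**: `(2/5)·Σ|α m| ≤ ‖Σ α m • canonTriple m‖` — the coordinates of the combination are
`(α₁ + α₂, α₀ + α₂, α₀ + α₁)/√2`, so its squared norm is `(|α|₂² + (α₀ + α₁ + α₂)²)/2 ≥ |α|₂²/2 ≥ |α|₁²/6 ≥ (4/25)|α|₁²`. -/
theorem isLowerFat_canonTriple : IsLowerFat (2 / 5) canonTriple := by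
  intro α
  set z : E3 := ∑ m, α m • canonTriple m with hz
  have h0 : z 0 = (Real.sqrt 2)⁻¹ * (α 1 + α 2) := by
    simp [hz, canonTriple, canonInt, Fin.sum_univ_three]; ring
  have h1 : z 1 = (Real.sqrt 2)⁻¹ * (α 0 + α 2) := by
    simp [hz, canonTriple, canonInt, Fin.sum_univ_three]; ring
  have h2 : z 2 = (Real.sqrt 2)⁻¹ * (α 0 + α 1) := by
    simp [hz, canonTriple, canonInt, Fin.sum_univ_three]; ring
  have hn : ‖z‖ ^ 2 = z 0 ^ 2 + z 1 ^ 2 + z 2 ^ 2 := by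
    rw [EuclideanSpace.real_norm_sq_eq, Fin.sum_univ_three]
  have hs2 : ((Real.sqrt 2)⁻¹) ^ 2 = 1 / 2 := by
    rw [inv_pow, Real.sq_sqrt (by norm_num : (0 : ℝ) ≤ 2)]; norm_num
  have hS : 0 ≤ 2 / 5 * ∑ m, |α m| := by positivity
  refine (sq_le_sq₀ hS (norm_nonneg z)).1 ?_
  rw [hn, h0, h1, h2, Fin.sum_univ_three, mul_pow, mul_pow, mul_pow, mul_pow, hs2]
  nlinarith [sq_abs (α 0), sq_abs (α 1), sq_abs (α 2), sq_nonneg (|α 0| - |α 1|), sq_nonneg (|α 0| - |α 2|),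
    sq_nonneg (|α 1| - |α 2|), sq_nonneg (α 0 + α 1 + α 2), abs_nonneg (α 0), abs_nonneg (α 1), abs_nonneg (α 2)]

end Canon

/-! ### ZZZXC-3  The tripod constructor (PROVED) -/

section Tripod

variable {n : ℕ} {Rd a τ μ : ℝ} {y₀ : Fin n → E3} {p j : Fin n} {tr : Fin 3 → Fin n}

/-- three vectors within `τ` of a scaled rotated canonical triple are `((2/5)·a − τ)`-lower-fat (PROVED). -/
theorem isLowerFat_of_near_canonTriple {w : Fin 3 → E3} (A : E3 →ₗᵢ[ℝ] E3) (ha : 0 ≤ a) (hw : ∀ m, ‖w m - a • A (canonTriple m)‖ ≤ τ) :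
    IsLowerFat (2 / 5 * a - τ) w := by
  have h := isLowerFat_of_near (isLowerFat_smul_map A ha isLowerFat_canonTriple) hw
  rwa [mul_comm] at h

/-- ★★ **THE TRIPOD CONSTRUCTOR (PROVED)** — at node `j` with parent `p`: three sites `tr m` whose positions are within `τ` of
`y₀ j + a • A (canonTriple m)` (`A` a linear isometry, `a ≥ 0` — e.g. the label-preimages of the canonical triple of the clean first shell of the label
`y₀ j`, `τ = a/16 + ϑr`) and which are in range `Rd` of `p` and of `j`, form a `TripodAt Rd μ y₀ p j tr` for every `0 < μ ≤ (2/5)·a − τ`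
(record `a ≥ 9/10`: any `μ ≤ 3/10` — far above the `249/20000` the door consumes). -/
theorem tripodAt_of_near_canonTriple (A : E3 →ₗᵢ[ℝ] E3) (ha : 0 ≤ a) (hnear : ∀ m, dist (y₀ (tr m)) (y₀ j + a • A (canonTriple m)) ≤ τ)
    (hμ : 0 < μ) (hμ' : μ ≤ 2 / 5 * a - τ) (hrange : ∀ m, dist (y₀ p) (y₀ (tr m)) ≤ Rd ∧ dist (y₀ j) (y₀ (tr m)) ≤ Rd) :
    TripodAt Rd μ y₀ p j tr := by
  refine ⟨hrange, exists_coeff_of_isLowerFat hμ ((isLowerFat_of_near_canonTriple A ha fun m => ?_).mono hμ')⟩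
  rw [← dist_eq_norm, sub_eq_add_neg]  -- `‖(y₀ (tr m) - y₀ j) - a • A c‖ = dist (y₀ (tr m)) (y₀ j + a • A c)`
  have e : dist (y₀ (tr m) + -y₀ j) (a • A (canonTriple m)) = dist (y₀ (tr m)) (y₀ j + a • A (canonTriple m)) := by
    rw [dist_eq_norm, dist_eq_norm]; congr 1; abel
  rw [e]; exact hnear m

end Tripod

/-! ### ZZZXC-4  The label diameter comes for free from the tree clauses (PROVED) -/

section Diam

variable {n : ℕ} {Rd μ : ℝ} {H : ℕ} {y₀ : Fin n → E3} {i₀ : Fin n} {par : Fin n → Fin n} {dep : Fin n → ℕ} {t : Fin n → Fin 3 → Fin n}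

/-- along parents (PROVED): every site is within `dep j · Rd` of the root (no sign hypothesis: a non-root site forces `0 ≤ Rd`). -/
theorem dist_root_le_of_treeClauses (hroot : ∀ j, dep j = 0 → j = i₀) (hdec : ∀ j, dep j ≠ 0 → dep (par j) < dep j)
    (hpar : ∀ j, dep j ≠ 0 → dist (y₀ (par j)) (y₀ j) ≤ Rd) :
    ∀ (d : ℕ) (j : Fin n), dep j ≤ d → dist (y₀ i₀) (y₀ j) ≤ dep j * Rd := by
  intro d
  induction d with
  | zero =>
      intro j hj
      have h0 : dep j = 0 := Nat.le_zero.1 hj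
      rw [h0, Nat.cast_zero, zero_mul, hroot j h0, dist_self]
  | succ d ih =>
      intro j hj
      by_cases h0 : dep j = 0
      · rw [h0, Nat.cast_zero, zero_mul, hroot j h0, dist_self]
      · have hRd : 0 ≤ Rd := dist_nonneg.trans (hpar j h0)
        have hle : ((dep (par j) : ℕ) : ℝ) + 1 ≤ dep j := by exact_mod_cast Nat.succ_le_of_lt (hdec j h0)
        calc dist (y₀ i₀) (y₀ j) ≤ dist (y₀ i₀) (y₀ (par j)) + dist (y₀ (par j)) (y₀ j) := dist_triangle _ _ _
          _ ≤ dep (par j) * Rd + Rd := add_le_add (ih (par j) (Nat.lt_succ_iff.1 (lt_of_lt_of_le (hdec j h0) hj))) (hpar j h0)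
          _ = (dep (par j) + 1) * Rd := by ring
          _ ≤ dep j * Rd := mul_le_mul_of_nonneg_right hle hRd

/-- ★ THE DIAMETER FOR FREE (PROVED): root + depth decrease + depth `≤ H` + parent in range `Rd ≥ 0` ⇒ label diameter `≤ 2·H·Rd`. -/
theorem dist_le_of_treeClauses (hRd : 0 ≤ Rd) (hroot : ∀ j, dep j = 0 → j = i₀) (hdec : ∀ j, dep j ≠ 0 → dep (par j) < dep j)
    (hH : ∀ j, dep j ≤ H) (hpar : ∀ j, dep j ≠ 0 → dist (y₀ (par j)) (y₀ j) ≤ Rd) (i k : Fin n) :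
    dist (y₀ k) (y₀ i) ≤ 2 * H * Rd := by
  have h := dist_root_le_of_treeClauses hroot hdec hpar H
  have hk : dist (y₀ i₀) (y₀ k) ≤ H * Rd :=
    (h k (hH k)).trans (mul_le_mul_of_nonneg_right (by exact_mod_cast hH k) hRd)
  have hi : dist (y₀ i₀) (y₀ i) ≤ H * Rd :=
    (h i (hH i)).trans (mul_le_mul_of_nonneg_right (by exact_mod_cast hH i) hRd)
  rw [dist_comm] at hk
  calc dist (y₀ k) (y₀ i) ≤ dist (y₀ k) (y₀ i₀) + dist (y₀ i₀) (y₀ i) := dist_triangle _ _ _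
    _ ≤ H * Rd + H * Rd := add_le_add hk hi
    _ = 2 * H * Rd := by ring

/-- ★★ **THE LIGHT TREE WITHOUT A DIAMETER COMPUTATION (PROVED)** — the five structural clauses (root, depth decrease, depth `≤ H`, parent in label range
`Rd ≥ 0`, tripods at internal nodes) give `IsLightLabelTree Rd μ (2·H·Rd) H y₀ i₀ par dep t`; so (RG-lab″) may be met with `ΔC := 2·H₀·Rd`. -/
theorem isLightLabelTree_of_clauses (hRd : 0 ≤ Rd) (hroot : ∀ j, dep j = 0 → j = i₀) (hdec : ∀ j, dep j ≠ 0 → dep (par j) < dep j)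
    (hH : ∀ j, dep j ≤ H) (hpar : ∀ j, dep j ≠ 0 → dist (y₀ (par j)) (y₀ j) ≤ Rd)
    (htri : ∀ i, dep i ≠ 0 → dep (par i) ≠ 0 → TripodAt Rd μ y₀ (par (par i)) (par i) (t (par i))) :
    IsLightLabelTree Rd μ (2 * H * Rd) H y₀ i₀ par dep t :=
  ⟨hroot, hdec, hH, hpar, htri, dist_le_of_treeClauses hRd hroot hdec hH hpar⟩

end Diam

/-! ### ZZZXC-5  The descent hop at a clean point of `S` itself (PROVED) -/

section Hop

/-- ★ THE DESCENT STEP AT A CLEAN POINT (PROVED) — the `S`-version of tree ZZZVA `shadow_descent_step`, with no shadow and no placement: at a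
`(1/16, 9/10, 1)`-two-shell-good point `q` of a set `Y` and for any target `q + g`, one of `q`'s first-shell sites `q' ∈ Y` is within `a/16` of an ideal
point `y` with `dist y q = a` (`a ∈ [9/10, 1]` the local scale) and the `45°` covering progress `dist (y, q + g)² ≤ ‖g‖² − √2·a·‖g‖ + a²`. -/
theorem clean_descent_step {Y : Set E3} {q : E3} (hq : IsTwoShellGoodSet (1 / 16) (9 / 10) 1 Y q) (g : E3) :
    ∃ a : ℝ, 9 / 10 ≤ a ∧ a ≤ 1 ∧ ∃ q' ∈ Y, ∃ y : E3,
      dist q' y ≤ a / 16 ∧ dist y q = a ∧ dist y (q + g) ^ 2 ≤ ‖g‖ ^ 2 - Real.sqrt 2 * a * ‖g‖ + a ^ 2 := by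
  obtain ⟨a, ha1, ha2, A, P, f, hP, hf, -, -⟩ := hq
  have ha0 : 0 < a := by linarith
  set Ae := A.toLinearIsometryEquiv rfl with hAe
  obtain ⟨v, hvP, hv1, hv⟩ := exists_unit_inner_ge_of_pattern hP (Ae.symm g)
  have hAd : A (Ae.symm g) = g := by
    have h := LinearIsometryEquiv.apply_symm_apply Ae g
    rw [hAe, LinearIsometry.toLinearIsometryEquiv_apply] at h
    rw [hAe]
    exact h
  have hAv : ⟪g, A v⟫ = ⟪Ae.symm g, v⟫ := by rw [← A.inner_map_map (Ae.symm g) v, hAd]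
  rw [LinearIsometryEquiv.norm_map] at hv
  obtain ⟨hfv, hfvd⟩ := hf v hvP
  have haAv : ‖a • A v‖ = a := by rw [norm_smul, A.norm_map, hv1, mul_one, Real.norm_eq_abs, abs_of_pos ha0]
  refine ⟨a, ha1, ha2, f v, hfv, q + a • A v, ?_, ?_, ?_⟩
  · calc dist (f v) (q + a • A v) ≤ 1 / 16 * a := hfvd
      _ = a / 16 := by ring
  · rw [dist_eq_norm, add_sub_cancel_left, haAv]
  · have e1 : q + a • A v - (q + g) = a • A v - g := by abel
    rw [dist_eq_norm, e1]
    have htv : ‖g‖ ≤ Real.sqrt 2 * ⟪g, A v⟫ := by rw [hAv]; exact hv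
    have hsq : ‖a • A v - g‖ ^ 2 = a ^ 2 - 2 * a * ⟪g, A v⟫ + ‖g‖ ^ 2 := by
      rw [norm_sub_sq_real, haAv, real_inner_smul_left, real_inner_comm g (A v)]; ring
    rw [hsq]
    have hs : Real.sqrt 2 * Real.sqrt 2 = 2 := Real.mul_self_sqrt (by norm_num)
    have h2 : Real.sqrt 2 * a * ‖g‖ ≤ 2 * a * ⟪g, A v⟫ := by
      have := mul_le_mul_of_nonneg_left htv (by positivity : (0 : ℝ) ≤ Real.sqrt 2 * a)
      calc Real.sqrt 2 * a * ‖g‖ ≤ Real.sqrt 2 * a * (Real.sqrt 2 * ⟪g, A v⟫) := this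
        _ = Real.sqrt 2 * Real.sqrt 2 * a * ⟪g, A v⟫ := by ring
        _ = 2 * a * ⟪g, A v⟫ := by rw [hs]
    linarith

/-- ★ THE FAR-REGIME STEP ARITHMETIC (PROVED) — companion of tree ZZZVA `descent_gain`: for distance to the target `D ≥ 3` the same inputs give the LINEAR
gain `τ + W ≤ D − 9/20` (three such hops gain `27/20`, the band-3 parent of PLAN-g90-RGlab §2). -/
theorem descent_gain_far {a D τ W : ℝ} (ha1 : 9 / 10 ≤ a) (ha2 : a ≤ 1) (hD : 3 ≤ D) (hτ0 : 0 ≤ τ) (hτ : τ ≤ a / 16 + 1 / 10000) (hW0 : 0 ≤ W)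
    (hW : W ^ 2 ≤ D ^ 2 - Real.sqrt 2 * a * D + a ^ 2) : τ + W ≤ D - 9 / 20 := by
  have hs2 : (14142 / 10000 : ℝ) < Real.sqrt 2 := sqrt_two_window.1
  have hD0 : 0 ≤ D := by linarith
  have hW' : W ^ 2 ≤ D ^ 2 - 14142 / 10000 * a * D + a ^ 2 := by
    nlinarith [mul_nonneg (mul_nonneg (by linarith : (0:ℝ) ≤ a) hD0) (sub_nonneg.2 hs2.le)]
  set T : ℝ := a / 16 + 1 / 10000 with hT
  have hκ : 9 / 10 + 2 * T - 14142 / 10000 * a ≤ 0 := by rw [hT]; linarith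
  have hstep : D ^ 2 - 14142 / 10000 * a * D + a ^ 2 ≤ (D - 9 / 20 - T) ^ 2 := by
    nlinarith [mul_nonneg (sub_nonneg.2 hD) (neg_nonneg.2 hκ), mul_nonneg (sub_nonneg.2 ha1) (sub_nonneg.2 ha2)]
  have hM0 : 0 ≤ D - 9 / 20 - T := by rw [hT]; linarith
  have hmono : (D - 9 / 20 - T) ^ 2 ≤ (D - 9 / 20 - τ) ^ 2 := by
    nlinarith [mul_nonneg (sub_nonneg.2 hτ) (show 0 ≤ (D - 9 / 20 - T) + (D - 9 / 20 - τ) by linarith)]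
  have hWM : W ≤ D - 9 / 20 - τ := (sq_le_sq₀ hW0 (by linarith)).1 (hW'.trans (hstep.trans hmono))
  linarith

/-- ★★ **ONE HOP IN `S`, NEAR REGIME (PROVED)** — at a clean point `q ∈ Y` at distance `D ≥ 4/5` from a target `x` there is a BONDED site `q' ∈ Y`
(`q' ≠ q`, `dist q q' ≤ 17/16`) with `dist (q', x)² ≤ D² − 1/100`. -/
theorem clean_hop_sq {Y : Set E3} {q x : E3} (hq : IsTwoShellGoodSet (1 / 16) (9 / 10) 1 Y q) (hD : 4 / 5 ≤ dist q x) :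
    ∃ q' ∈ Y, q' ≠ q ∧ dist q q' ≤ 17 / 16 ∧ dist q' x ^ 2 ≤ dist q x ^ 2 - 1 / 100 := by
  obtain ⟨a, ha1, ha2, q', hq', y, hq'y, hyq, hprog⟩ := clean_descent_step hq (x - q)
  rw [add_sub_cancel, norm_sub_rev, ← dist_eq_norm] at hprog
  have hgain := descent_gain ha1 ha2 hD dist_nonneg (by linarith : dist q' y ≤ a / 16 + 1 / 10000) dist_nonneg hprog
  refine ⟨q', hq', ?_, ?_, ?_⟩
  · intro h
    rw [h] at hq'y
    have hc : dist q y = a := by rw [dist_comm]; exact hyq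
    linarith
  · calc dist q q' ≤ dist q y + dist y q' := dist_triangle _ _ _
      _ ≤ a + a / 16 := add_le_add (by rw [dist_comm, hyq]) (by rw [dist_comm]; exact hq'y)
      _ ≤ 17 / 16 := by linarith
  · have htri : dist q' x ≤ dist q' y + dist y x := dist_triangle _ _ _
    exact (pow_le_pow_left₀ dist_nonneg htri 2).trans hgain

/-- ★★ **ONE HOP IN `S`, FAR REGIME (PROVED)** — at distance `D ≥ 3` from the target the bonded site gains `9/20`: `dist (q', x) ≤ D − 9/20`. -/
theorem clean_hop_far {Y : Set E3} {q x : E3} (hq : IsTwoShellGoodSet (1 / 16) (9 / 10) 1 Y q) (hD : 3 ≤ dist q x) :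
    ∃ q' ∈ Y, q' ≠ q ∧ dist q q' ≤ 17 / 16 ∧ dist q' x ≤ dist q x - 9 / 20 := by
  obtain ⟨a, ha1, ha2, q', hq', y, hq'y, hyq, hprog⟩ := clean_descent_step hq (x - q)
  rw [add_sub_cancel, norm_sub_rev, ← dist_eq_norm] at hprog
  have hgain := descent_gain_far ha1 ha2 hD dist_nonneg (by linarith : dist q' y ≤ a / 16 + 1 / 10000) dist_nonneg hprog
  refine ⟨q', hq', ?_, ?_, (dist_triangle q' y x).trans hgain⟩
  · intro h
    rw [h] at hq'y
    have hc : dist q y = a := by rw [dist_comm]; exact hyq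
    linarith
  · calc dist q q' ≤ dist q y + dist y q' := dist_triangle _ _ _
      _ ≤ a + a / 16 := add_le_add (by rw [dist_comm, hyq]) (by rw [dist_comm]; exact hq'y)
      _ ≤ 17 / 16 := by linarith

end Hop

end Summit.AtomisticToContinuum.Crystallization.Theorems.ChartedZeroExcessLayeredLatticeLiouville

end
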